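import Summits.QuantumFields.BalabanUV.T4Continuum.Support.NE9PencilEndSharp
import Summits.QuantumFields.BalabanUV.T4Continuum.Support.NE9VacuumSubtractedBridge

/-!
# NE9AugmentedPencil — ROUTE R1′♯-AUG, PART 1 (the ENGINE): the COUPLING HALF `LastCouplingLipschitz` of BOTH co-leads (R4♯, R3′) DERIVED at
# KP(m) from ONE pencil letter on the AUGMENTED table space `Pot × ℂ` — the complex last coupling adjoined as one more polydisc coordinate;
# NO `TwoPointKP`, NO KP(2m) (`hkp2`), NO coupling two-point `hCup`, NO `hclip`; constant `2·B₀ k∕(R₀ − s₀)·max (cd k) (qT k)` (a MAX, not a sum)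

Cell `pub-balaban`, T4-DAG §6 row NE9; NE9 crux team (coordinator ruling «YM REDIRECT» e34b3e0c (2)), leaf lineage
`b2b-balaban-t4-ne9-formalise-leaf-06` generation 40; route R1′♯-AUG «the augmented pencil» of `t4/ROUTES-NE9.md` v9∕v10 §L1.1 — NOT a fifth route
(idea-1's HONEST LABEL; refuter PRICING-NE9 v11 F-v11-3: «correct, rate-inert, ≤ ×2 on ℓ's coupling part, an instance SUBSTITUTION not a reduction,
serves both co-leads ⇒ rank-neutral; T22 fires on an ACCEPTED Support lift of §3–§6»).  ENGINE AND AUTHORSHIP OF THE LEAN BELOW: the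
crux-ideation seat `b2b-balaban-t4-ne9-idea-1` generation 9 (lens 1 = analytic dependence ∕ implicit-function ∕ fixed-point operators), HOME
scratch `t4/ideate/NE9/lens1-NE9AugmentedPencil.lean` sha16 398adf3ef5349051 (459 l.; kernel-checked rc 0 ∣ 0 ∣ 0, axioms {propext,
Classical.choice, Quot.sound} by its author and by the pricing desk `t4-ne9-refuter` g11) — §0–§3 reproduced here VERBATIM under the tree
namespace (only the namespace, the split into two ≤ 400-l. files, the import list and the headers differ; docstrings kept), FILED by leaf-06 on
idea-1's OFFER O-v9-AUG («any holder — leaf-06 successor for §5, owner∕leaf-05 for §4∕§6 — may lift §0–§3 … verbatim modulo namespace», ROUTES v10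
TOP-TWO HANDOFF «R3′ → leaf-06») after the row OWNER `t4-ne9-p1` g62 declined it for his lineage ((W6) «no owner filing on it this gen»); journal
INTENT 3 l.30393.  PART 2 `NE9AugmentedPencilEnd` carries the ENDs (§4 re-cut TWO-RADII per the desk's A-v11-1, §5 R3′, junctions).

THE MOVE (idea-1 §L1.1, verbatim in substance).  The tree's coupling half of (L) runs on the COUPLING TWO-POINT letter `hCup` (+ `hclip`, and — in
every END that derives it from a pencil — `TwoPointKP`, i.e. KP for `2m` = `hkp2`): E131∕E134 §1, leaf-06's `NE9VacuumSubtractedBridgeFloor` §2;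
constant `2·clip·B + 2·B∕(R₀ − s₀)·qT`.  Here that display is ONE letter in the tree's OWN vocabulary: `hKPA : G.PotentialKPG W actA m a d R₀` for
an AUGMENTED activity `actA : ℕ → ℝ → Bg → Pot × ℂ → G.P → ℂ` (Mathlib's product norm on `Pot × ℂ` is the sup norm, so `ℓ^∞(ι;ℂ) × ℂ` is again a
polydisc space and `‖(Q, ζ)‖ < R₀` is the bidisc «table ball × coupling disc»), plus the READING identity `hread : act k (g′ k) U Q γ = actA k (g k)
U (Q, disp k (g k) (g′ k)) γ` for a DISPLACEMENT `disp : ℕ → ℝ → ℝ → ℝ` with `disp k s s = 0` («the activity at real coupling `g′ k` is the augmented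
activity based at `g k` read at the real displacement») that is CURRENCY-BLIND — the kernel only displays the window's two moduli `|disp k (g k)
(g′ k)| ≤ s₀` (the window sits inside the inner bidisc) and `|disp k (g k) (g′ k)| ≤ cd k·|g k − g′ k|`.  THEN: (§1) the un-augmented pencil
`PotentialKPG W act m a d R₀` is the slice `ζ = 0`; (§2) the row owner's STADIUM bound `NE9PencilEndSharp.norm_clusterSum_sub_le_of_ballKPG_sharp`
(E128 p256040, constant 1) run ONCE on `Pot × ℂ` between the augmented points `(ρP, 0)` and `(ρP′, disp)` bounds the new-term difference ACROSS
BOTH the table and the coupling by `a(γ)e^{−δ}∕(R₀ − s₀) · max ‖ρP − ρP′‖ |disp|`; (§3) `LastCouplingLipschitz E W T Ψ κ (fun k ↦ 2·B₀ k∕(R₀ −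
s₀)·max (cd k) (qT k))` under the vacuum-subtracted shape (the explicit part `explZ` cancels BY TYPE — the desk's F-v11-4 ∕ Q-v9-explZ CLOSED).
INSTANCE DELTA (priced by the desk, F-v11-3): {`hhol`, `hsup`, `hkp2` ∕ `TwoPointKP`, `hCup`, `hclip0`∕`hclipb`} ↦ {`hKPA`, `hread`, `hdisp0`,
`hdispW`, `hdispL`, `hcd0`∕`hcdb`} — a SUBSTITUTION (wall item W2 coupling ↦ W2-AUG), FAIR not free; (AUG-c) `|disp| ≤ s₀` ties the coupling window
to the table's inner radius (a constraint for the instancer to DISPLAY, not a defect).  RATE-INERT: only `ℓ` moves.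

HONEST FRAMING (T4-DAG PAGE 1).  Rung (B)+1 of the FINITE-VOLUME T⁴ programme — NOT infinite volume, NOT a mass gap, NOT the Clay problem.  NE9
(`T4OutputRate.NE9` ∧ `FadingMemory`) is a cell NEW ESTIMATE, NOT PRINTED in [I] = [Balaban1987RG1] (CMP **109**), [II] = [Balaban1988RG2Cluster]
(CMP **116**), NOT PROVED for Bałaban's E^{(j)}: every theorem below is «NE9 ⇐ the named binders» ∕ «(L) ⇐ the named binders».  The augmented
pencil `hKPA` is EXACTLY AS UNPRINTED as the coupling two-point `hCup` it replaces (idea-1's own label): printed TYPE [I] p. 263 «a C^∞-function of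
g_{j−1} ∈ [0, γ], (or analytic)» and [II] (2.14)–(2.15) p. 15, Lemma 3 (2.38) p. 20 for ONE table at ONE real coupling; the uniformity over the
bidisc is a DISPLAYED hypothesis (the desk's wall item W2-AUG in place of W2's coupling item); W1 = the model O-NE9-1 untouched (PARKED under FREEZE
(0)); row NE9 WALLED ON A MODEL; spine PROVED 0∕9.  HONEST DEPENDENCY (cell line, verbatim): continuum YM on T⁴ ⇐ BetaPertH ∧ nine spine estimates
(0/9 proved); BetaPertH ⇐ (D1) ∧ (D4) ∧ CAP+tail; G-an2-4 gates asym, D1 and NE2/3/4.  `FlowStep.BetaPertH`, (B), (B^μ) do not occur; [I]∕[II]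
for TYPES only (ABSOLUTE RULE).

CONTENT ([folklore]; 0 def, 0 Prop-valued definition, 0 sorry) — idea-1 §0–§3 VERBATIM:
* §0 `norm_inl_eq`, `norm_aug_sub`, `norm_aug_le` — the sup norm of `Pot × ℂ` on the two augmented points.
* §1 **`potentialKPG_of_augmented`** — `hKPA` + `hread` + `hdisp0` ⇒ `PotentialKPG W act m a d R₀` (the slice `ζ = 0`).
* §2 **`norm_newTerm_sub_le_of_augmented`** — `‖newTerm act k (g k) V X Q − newTerm act k (g′ k) V X Q′‖ ≤ B₀ k·e^{−κd(X)}∕(R₀ − s₀)·max ‖Q − Q′‖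
  |disp k (g k) (g′ k)|` for `‖Q‖, ‖Q′‖, |disp| ≤ s₀ < R₀` (E128 §D on `Pot × ℂ`).
* §3 **`lastCouplingLipschitz_of_augmentedPencil`** — ⊢ `LastCouplingLipschitz E W T Ψ κ (fun k ↦ 2·B₀ k∕(R₀ − s₀)·max (cd k) (qT k))` from `hKPA`,
  `hread`∕`hdisp0`, `hdispW`∕`hdispL`, the box `𝒜 k ⊆ closedBall 0 s₀`, decay, pin budget, reading law `hρ`, shape `hreprV`, `hTcup`, occupation `hocc`.
DISGUISE TEST: one-variable complex analysis on a product space over the tree's own KP ∕ cluster-expansion lemmas, composed by name; nothing of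
Bałaban's asserted; no named fact; not NE9 ∕ not (L) for Bałaban's terms.  WHAT THIS DOES NOT DO: it does not REMOVE the coupling-half instance
burden, it MOVES it into `hKPA` (one more (R-0)-type scope clause, W2-AUG); no activity, species or estimate of the series is touched; E128 and
`NE9VacuumSubtractedBridge` (for `abs_re_sub_re_le`) are imported BY NAME and not modified.

References (TYPES ∕ loci only): [Balaban1987RG1] T. Bałaban, CMP **109** (1987) 249–301 — p. 263 (1.18), (2.12)–(2.14) p. 268; [Balaban1988RG2Cluster]
T. Bałaban, CMP **116** (1988) 1–22 — (1.36) p. 9, (2.14)–(2.15) p. 15, Lemma 3 (2.38) p. 20, (2.40)–(2.41) p. 21; [KoteckyPreiss1986] CMP **103**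
(1986) 491–498, p. 492–493.  Summits-side NEW work (LEAN PLACEMENT RULE); modifies nothing; 0 sorry.  Value = an alternative, kernel-checked
(L)-supplier for both co-leads' conditional ENDs (refuter T22), NOT summit progress.
-/

noncomputable section

namespace Summit.QuantumFields.BalabanUV.T4Continuum.NE9AugmentedPencil

open Metric Set
open scoped BigOperators ENNReal
open Literature.Probability.LatticeModels
open Literature.MathematicalPhysics.QuantumFieldTheory.Balaban1983to89
open Literature.MathematicalPhysics.QuantumFieldTheory.Balaban1983to89.T4OutputRate
open Literature.MathematicalPhysics.QuantumFieldTheory.Balaban1983to89.T4ActivityLipschitz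
open Literature.MathematicalPhysics.QuantumFieldTheory.Balaban1983to89.T4HistoryLipschitzRecursion
open Literature.MathematicalPhysics.QuantumFieldTheory.Balaban1983to89.T4HistoryLipschitzOuter
open Literature.MathematicalPhysics.QuantumFieldTheory.Balaban1983to89.T4HistoryLipschitzActivity
open Literature.MathematicalPhysics.QuantumFieldTheory.Balaban1983to89.T4HistoryLipschitzActivity (ClusterGeom)
open Summit.QuantumFields.BalabanUV.T4Continuum.NE9PencilEndSharp (norm_clusterSum_sub_le_of_ballKPG_sharp)
open Summit.QuantumFields.BalabanUV.T4Continuum.NE9VacuumSubtractedBridge (abs_re_sub_re_le)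

section Augmented

variable {C : Carriers} (G : ClusterGeom C) {Bg : Type} {Pot : Type*} [NormedAddCommGroup Pot] [NormedSpace ℂ Pot]

/-! ## §0 Two norms in the augmented table space `Pot × ℂ` (sup norm) -/

omit [NormedSpace ℂ Pot] in
/-- [folklore] `‖(Q, 0)‖ = ‖Q‖` in `Pot × ℂ`. -/
theorem norm_inl_eq (Q : Pot) : ‖((Q, (0 : ℂ)) : Pot × ℂ)‖ = ‖Q‖ := by
  rw [Prod.norm_mk, norm_zero, max_eq_left (norm_nonneg _)]

omit [NormedSpace ℂ Pot] in
/-- [folklore] `‖(Q, 0) − (Q′, t)‖ = max ‖Q − Q′‖ |t|` in `Pot × ℂ`, `t` real. -/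
theorem norm_aug_sub (Q Q' : Pot) (t : ℝ) : ‖((Q, (0 : ℂ)) : Pot × ℂ) - (Q', (t : ℂ))‖ = max ‖Q - Q'‖ |t| := by
  rw [Prod.mk_sub_mk, Prod.norm_mk, zero_sub, norm_neg, Complex.norm_real, Real.norm_eq_abs]

omit [NormedSpace ℂ Pot] in
/-- [folklore] `‖(Q′, t)‖ ≤ s₀` when `‖Q′‖ ≤ s₀` and `|t| ≤ s₀`. -/
theorem norm_aug_le {Q' : Pot} {t s₀ : ℝ} (hQ' : ‖Q'‖ ≤ s₀) (ht : |t| ≤ s₀) : ‖((Q', (t : ℂ)) : Pot × ℂ)‖ ≤ s₀ := by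
  rw [Prod.norm_mk, Complex.norm_real, Real.norm_eq_abs]
  exact max_le hQ' ht

/-! ## §1 The augmented pencil restricts to the pencil: `PotentialKPG` on `Pot × ℂ` + the reading identity ⇒ `PotentialKPG` on `Pot` -/

/-- [folklore] **THE SLICE `ζ = 0` OF THE AUGMENTED PENCIL IS THE PENCIL.**  `hKPA : PotentialKPG W actA m a d R₀` on `Pot × ℂ` and
the reading identity `act k (g′ k) U Q γ = actA k (g k) U (Q, disp k (g k) (g′ k)) γ` (on the window, the step volume and the table
ball; `disp k s s = 0`) give `PotentialKPG W act m a d R₀`: line-holomorphy along `(Q₀, 0) + z•(V, 0)`, majorant at `(Q, 0)`, KP verbatim.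
[cite: Balaban1988RG2Cluster, (2.14)-(2.15) p.15 and Lemma 3 (2.38) p.20; Balaban1987RG1, p.263 (1.18)] -/
theorem potentialKPG_of_augmented {W : Set (ℕ → ℝ)} {act : ℕ → ℝ → Bg → Pot → G.P → ℂ}
    {actA : ℕ → ℝ → Bg → Pot × ℂ → G.P → ℂ} {m : ℕ → ℝ → Bg → G.P → ℝ} {a d : G.P → ℝ} {R₀ : ℝ} {disp : ℕ → ℝ → ℝ → ℝ}
    (hKPA : G.PotentialKPG W actA m a d R₀)
    (hread : ∀ g ∈ W, ∀ g' ∈ W, ∀ (k : ℕ) (U : Bg) (X : C.Dom), C.scale X = k + 1 →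
      ∀ Q ∈ ball (0 : Pot) R₀, ∀ γ ∈ G.vol X, act k (g' k) U Q γ = actA k (g k) U (Q, ((disp k (g k) (g' k) : ℝ) : ℂ)) γ)
    (hdisp0 : ∀ (k : ℕ) (s : ℝ), disp k s s = 0) :
    G.PotentialKPG W act m a d R₀ := by
  obtain ⟨ha, hd, hP⟩ := hKPA
  refine ⟨ha, hd, fun g hg k U X hX => ?_⟩
  obtain ⟨hhol, hmaj, hkp⟩ := hP g hg k U X hX
  have hread0 : ∀ Q ∈ ball (0 : Pot) R₀, ∀ γ ∈ G.vol X, act k (g k) U Q γ = actA k (g k) U (Q, 0) γ := by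
    intro Q hQ γ hγ
    have h := hread g hg g hg k U X hX Q hQ γ hγ
    rw [hdisp0] at h
    simpa only [Complex.ofReal_zero] using h
  refine ⟨fun γ hγ Q₀ V => ?_, fun Q hQ γ hγ => ?_, hkp⟩
  · have hlin : ∀ z : ℂ, ((Q₀, (0 : ℂ)) : Pot × ℂ) + z • ((V, (0 : ℂ)) : Pot × ℂ) = (Q₀ + z • V, 0) := fun z => by
      simp only [Prod.smul_mk, Prod.mk_add_mk, smul_zero, add_zero]
    have hS : {z : ℂ | ((Q₀, (0 : ℂ)) : Pot × ℂ) + z • ((V, (0 : ℂ)) : Pot × ℂ) ∈ ball (0 : Pot × ℂ) R₀} =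
        {z : ℂ | Q₀ + z • V ∈ ball (0 : Pot) R₀} := by
      ext z
      simp only [mem_setOf_eq, hlin, mem_ball_zero_iff, norm_inl_eq]
    have h := (hhol γ hγ) (Q₀, 0) (V, 0)
    rw [hS] at h
    refine h.congr fun z hz => ?_
    simp only [hlin]
    exact hread0 _ hz γ hγ
  · rw [hread0 Q hQ γ hγ]
    exact hmaj (Q, 0) (by rw [mem_ball_zero_iff, norm_inl_eq]; exact mem_ball_zero_iff.1 hQ) γ hγ

/-! ## §2 The STADIUM bound on the augmented space: one Cauchy estimate across table AND coupling -/

/-- [folklore] **NEW-TERM DIFFERENCE ACROSS TABLE AND COUPLING, CONSTANT 1, A MAX NOT A SUM.**  Under the augmented pencil `hKPA`,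
the reading identity (`disp k s s = 0`), decay and pin budget: for `g, g′ ∈ W`, a scale-(k+1) domain `X`, any background `V`, and tables
`‖Q‖, ‖Q′‖ ≤ s₀ < R₀` with `|disp k (g k) (g′ k)| ≤ s₀`,
`‖newTerm act k (g k) V X Q − newTerm act k (g′ k) V X Q′‖ ≤ B₀ k·e^{−κd(X)}∕(R₀ − s₀) · max ‖Q − Q′‖ |disp k (g k) (g′ k)|` —
`NE9PencilEndSharp.norm_clusterSum_sub_le_of_ballKPG_sharp` on `Pot × ℂ` between `(Q, 0)` and `(Q′, disp k (g k) (g′ k))`.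
[cite: Balaban1988RG2Cluster, Lemma 3 (2.38) p.20 and (2.40)-(2.41) p.21; Balaban1987RG1, p.263 (1.18)] -/
theorem norm_newTerm_sub_le_of_augmented {W : Set (ℕ → ℝ)} {act : ℕ → ℝ → Bg → Pot → G.P → ℂ}
    {actA : ℕ → ℝ → Bg → Pot × ℂ → G.P → ℂ} {m : ℕ → ℝ → Bg → G.P → ℝ} {a d : G.P → ℝ} {δ : C.Dom → ℝ}
    {B₀ : ℕ → ℝ} {κ R₀ s₀ : ℝ} {disp : ℕ → ℝ → ℝ → ℝ} (hKPA : G.PotentialKPG W actA m a d R₀)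
    (hread : ∀ g ∈ W, ∀ g' ∈ W, ∀ (k : ℕ) (U : Bg) (X : C.Dom), C.scale X = k + 1 →
      ∀ Q ∈ ball (0 : Pot) R₀, ∀ γ ∈ G.vol X, act k (g' k) U Q γ = actA k (g k) U (Q, ((disp k (g k) (g' k) : ℝ) : ℂ)) γ)
    (hdisp0 : ∀ (k : ℕ) (s : ℝ), disp k s s = 0) (hsR : s₀ < R₀) (hdec : G.DecayExtract δ d)
    (hpin : G.PinBudget a δ B₀ κ) {g g' : ℕ → ℝ} (hg : g ∈ W) (hg' : g' ∈ W) {k : ℕ} (V : Bg) {X : C.Dom}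
    (hX : C.scale X = k + 1) {Q Q' : Pot} (hQ : ‖Q‖ ≤ s₀) (hQ' : ‖Q'‖ ≤ s₀) (hΔ : |disp k (g k) (g' k)| ≤ s₀) :
    ‖G.newTerm act k (g k) V X Q - G.newTerm act k (g' k) V X Q'‖ ≤
      (B₀ k * Real.exp (-(κ * C.d X))) / (R₀ - s₀) * max ‖Q - Q'‖ |disp k (g k) (g' k)| := by
  obtain ⟨ha, hd, hP⟩ := hKPA
  obtain ⟨hhol, hmaj, hkp⟩ := hP g hg k V X hX
  have hϱ : 0 < R₀ - s₀ := sub_pos.mpr hsR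
  have hQR : Q ∈ ball (0 : Pot) R₀ := mem_ball_zero_iff.2 (hQ.trans_lt hsR)
  have hQ'R : Q' ∈ ball (0 : Pot) R₀ := mem_ball_zero_iff.2 (hQ'.trans_lt hsR)
  -- the two augmented points lie in the closed ball of radius s₀
  have hA : ‖((Q, (0 : ℂ)) : Pot × ℂ)‖ ≤ s₀ := by rw [norm_inl_eq]; exact hQ
  have hA' : ‖((Q', ((disp k (g k) (g' k) : ℝ) : ℂ)) : Pot × ℂ)‖ ≤ s₀ := norm_aug_le hQ' hΔ
  -- the new terms are the augmented cluster sums (reading identity on the clusters of X)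
  have h1 : G.newTerm act k (g k) V X Q = clusterSum G.inc (actA k (g k) V (Q, (0 : ℂ))) (G.clus X) := by
    unfold ClusterGeom.newTerm
    refine clusterSum_congr fun K hK γ hγ => ?_
    have h := hread g hg g hg k V X hX Q hQR γ (G.clus_sub X K hK hγ)
    rw [hdisp0] at h
    simpa only [Complex.ofReal_zero] using h
  have h2 : G.newTerm act k (g' k) V X Q' =
      clusterSum G.inc (actA k (g k) V (Q', ((disp k (g k) (g' k) : ℝ) : ℂ))) (G.clus X) := by
    unfold ClusterGeom.newTerm
    exact clusterSum_congr fun K hK γ hγ => hread g hg g' hg' k V X hX Q' hQ'R γ (G.clus_sub X K hK hγ)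
  have key := norm_clusterSum_sub_le_of_ballKPG_sharp (inc := G.inc) (w := fun QA => actA k (g k) V QA) ha hd hsR hhol
    hmaj hkp (G.pin_mem X) (G.clus_sub X) (G.clus_pin X) (hdec X) hA hA'
  rw [norm_aug_sub] at key
  have henv := hpin k X hX
  have hmax : 0 ≤ max ‖Q - Q'‖ |disp k (g k) (g' k)| := le_max_of_le_left (norm_nonneg _)
  rw [h1, h2]
  calc ‖clusterSum G.inc (actA k (g k) V (Q, (0 : ℂ))) (G.clus X) -
          clusterSum G.inc (actA k (g k) V (Q', ((disp k (g k) (g' k) : ℝ) : ℂ))) (G.clus X)‖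
      ≤ (a (G.pin X) * Real.exp (-(δ X))) / (R₀ - s₀) * max ‖Q - Q'‖ |disp k (g k) (g' k)| := key
    _ ≤ (B₀ k * Real.exp (-(κ * C.d X))) / (R₀ - s₀) * max ‖Q - Q'‖ |disp k (g k) (g' k)| :=
        mul_le_mul_of_nonneg_right (div_le_div_of_nonneg_right henv hϱ.le) hmax

/-! ## §3 `LastCouplingLipschitz` at KP(m) from the augmented pencil — no `TwoPointKP`, no `hkp2`, no `hCup`, no `hclip` -/

/-- [folklore] **THE BINDER (L), VACUUM-SUBTRACTED SHAPE, FROM THE AUGMENTED PENCIL.**  Displayed inputs: `hKPA` (augmented pencil on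
`Pot × ℂ`, KP for `m`), `hread` (reading identity, `disp k s s = 0`), the window's two displacement moduli `|disp k (g k) (g′ k)| ≤ s₀` and
`|disp k (g k) (g′ k)| ≤ cd k·|g k − g′ k|`, `s₀ < R₀`, the box `𝒜 k ⊆ closedBall 0 s₀`, decay, pin budget, the reading law `hρ`, the
record's shape `hreprV`, the channel's coupling modulus `hTcup` (NO sign condition on `qT k` or `cd k`) and the occupation `hocc`.  Conclusion:
`LastCouplingLipschitz E W T Ψ κ (fun k ↦ 2·B₀ k∕(R₀ − s₀)·max (cd k) (qT k))` (leaf-06's `lastCouplingLipschitz_of_couplingTwoPoint_vacSub_sharp`: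
`8·clip k·B₀ k + 2·B₀ k∕(R₀ − s₀)·qT k` from `TwoPointKP` + `hCup`).  Proof: §2 at `U` and at `U₀`; the explicit part `explZ` cancels. [cite: Balaban1987RG1, p.263 (1.18) and (2.13)-(2.14) p.268; Balaban1988RG2Cluster, (1.36) p.9, (2.38) p.20, (2.40)-(2.41) p.21] -/
theorem lastCouplingLipschitz_of_augmentedPencil {ι : Type} {E : Functional C Bg} {W : Set (ℕ → ℝ)}
    {T : ℕ → (ℕ → ℝ) → (Bg → C.Dom → ℝ) → ι → ℝ} {Ψ : ℕ → ℝ → (ι → ℝ) → Bg → C.Dom → ℝ}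
    {act : ℕ → ℝ → Bg → Pot → G.P → ℂ} {actA : ℕ → ℝ → Bg → Pot × ℂ → G.P → ℂ} {𝒜 : ℕ → Set Pot}
    {m : ℕ → ℝ → Bg → G.P → ℝ} {a d : G.P → ℝ} {δ : C.Dom → ℝ} {B₀ qT cd : ℕ → ℝ} {κ s₀ R₀ : ℝ} {wt : ℕ → ι → ℝ}
    {disp : ℕ → ℝ → ℝ → ℝ} (ρ : ℕ → (ι → ℝ) → Pot) (U₀ : Bg) (explZ : ℕ → Bg → C.Dom → ℝ)
    (hKPA : G.PotentialKPG W actA m a d R₀)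
    (hread : ∀ g ∈ W, ∀ g' ∈ W, ∀ (k : ℕ) (U : Bg) (X : C.Dom), C.scale X = k + 1 →
      ∀ Q ∈ ball (0 : Pot) R₀, ∀ γ ∈ G.vol X, act k (g' k) U Q γ = actA k (g k) U (Q, ((disp k (g k) (g' k) : ℝ) : ℂ)) γ)
    (hdisp0 : ∀ (k : ℕ) (s : ℝ), disp k s s = 0) (hsR : s₀ < R₀) (h𝒜 : ∀ k, 𝒜 k ⊆ closedBall (0 : Pot) s₀)
    (hdispW : ∀ g ∈ W, ∀ g' ∈ W, ∀ k : ℕ, |disp k (g k) (g' k)| ≤ s₀)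
    (hdispL : ∀ g ∈ W, ∀ g' ∈ W, ∀ k : ℕ, |disp k (g k) (g' k)| ≤ cd k * |g k - g' k|)
    (hdec : G.DecayExtract δ d) (hpin : G.PinBudget a δ B₀ κ)
    (hρ : ∀ (k : ℕ) (P P' : ι → ℝ) (M : ℝ), (∀ y, |P y - P' y| ≤ wt k y * M) → ‖ρ k P - ρ k P'‖ ≤ M)
    (hreprV : ∀ (k : ℕ) (s : ℝ) (P : ι → ℝ) (U : Bg) (X : C.Dom),
      Ψ k s P U X = (G.newTerm act k s U X (ρ k P)).re - (G.newTerm act k s U₀ X (ρ k P)).re + explZ k U X)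
    (hTcup : ∀ g ∈ W, ∀ g' ∈ W, ∀ (k : ℕ) (y : ι), |T k g (E g) y - T k g' (E g) y| ≤ wt k y * (qT k * |g k - g' k|))
    (hocc : ∀ g ∈ W, ∀ g' ∈ W, ∀ k : ℕ, ρ k (T k g' (E g)) ∈ 𝒜 k) :
    LastCouplingLipschitz E W T Ψ κ (fun k => 2 * B₀ k / (R₀ - s₀) * max (cd k) (qT k)) := by
  intro g hg g' hg' k U X hX
  set P : ι → ℝ := T k g (E g)
  set P' : ι → ℝ := T k g' (E g)
  have hQn : ‖ρ k P‖ ≤ s₀ := mem_closedBall_zero_iff.1 (h𝒜 k (hocc g hg g hg k))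
  have hQ'n : ‖ρ k P'‖ ≤ s₀ := mem_closedBall_zero_iff.1 (h𝒜 k (hocc g hg g' hg' k))
  have hϱ : 0 < R₀ - s₀ := sub_pos.mpr hsR
  have ha0 : 0 ≤ a (G.pin X) := hKPA.1 _
  have henv := hpin k X hX
  have hB0 : 0 ≤ (B₀ k * Real.exp (-(κ * C.d X))) / (R₀ - s₀) :=
    div_nonneg ((mul_nonneg ha0 (Real.exp_nonneg _)).trans henv) hϱ.le
  have hΔ : 0 ≤ |g k - g' k| := abs_nonneg _
  have hdist : ‖ρ k P - ρ k P'‖ ≤ qT k * |g k - g' k| :=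
    hρ k P P' (qT k * |g k - g' k|) fun y => hTcup g hg g' hg' k y
  have hmax : max ‖ρ k P - ρ k P'‖ |disp k (g k) (g' k)| ≤ max (cd k) (qT k) * |g k - g' k| :=
    max_le (hdist.trans (mul_le_mul_of_nonneg_right (le_max_right _ _) hΔ))
      ((hdispL g hg g' hg' k).trans (mul_le_mul_of_nonneg_right (le_max_left _ _) hΔ))
  -- §2 at any background V
  have h3 : ∀ V : Bg, ‖G.newTerm act k (g k) V X (ρ k P) - G.newTerm act k (g' k) V X (ρ k P')‖ ≤
      Real.exp (-(κ * C.d X)) * (B₀ k / (R₀ - s₀) * max (cd k) (qT k) * |g k - g' k|) := by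
    intro V
    calc ‖G.newTerm act k (g k) V X (ρ k P) - G.newTerm act k (g' k) V X (ρ k P')‖
        ≤ (B₀ k * Real.exp (-(κ * C.d X))) / (R₀ - s₀) * max ‖ρ k P - ρ k P'‖ |disp k (g k) (g' k)| :=
          norm_newTerm_sub_le_of_augmented G hKPA hread hdisp0 hsR hdec hpin hg hg' V hX hQn hQ'n (hdispW g hg g' hg' k)
      _ ≤ (B₀ k * Real.exp (-(κ * C.d X))) / (R₀ - s₀) * (max (cd k) (qT k) * |g k - g' k|) :=
          mul_le_mul_of_nonneg_left hmax hB0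
      _ = Real.exp (-(κ * C.d X)) * (B₀ k / (R₀ - s₀) * max (cd k) (qT k) * |g k - g' k|) := by ring
  rw [hreprV k (g k) P U X, hreprV k (g' k) P' U X]
  calc |(G.newTerm act k (g k) U X (ρ k P)).re - (G.newTerm act k (g k) U₀ X (ρ k P)).re + explZ k U X -
          ((G.newTerm act k (g' k) U X (ρ k P')).re - (G.newTerm act k (g' k) U₀ X (ρ k P')).re + explZ k U X)|
      = |(G.newTerm act k (g k) U X (ρ k P) - G.newTerm act k (g' k) U X (ρ k P')).re -
          (G.newTerm act k (g k) U₀ X (ρ k P) - G.newTerm act k (g' k) U₀ X (ρ k P')).re| := by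
        rw [Complex.sub_re, Complex.sub_re]; ring_nf
    _ ≤ ‖G.newTerm act k (g k) U X (ρ k P) - G.newTerm act k (g' k) U X (ρ k P')‖ +
          ‖G.newTerm act k (g k) U₀ X (ρ k P) - G.newTerm act k (g' k) U₀ X (ρ k P')‖ := abs_re_sub_re_le _ _
    _ ≤ Real.exp (-(κ * C.d X)) * (B₀ k / (R₀ - s₀) * max (cd k) (qT k) * |g k - g' k|) +
          Real.exp (-(κ * C.d X)) * (B₀ k / (R₀ - s₀) * max (cd k) (qT k) * |g k - g' k|) := add_le_add (h3 U) (h3 U₀)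
    _ = Real.exp (-(κ * C.d X)) * (2 * B₀ k / (R₀ - s₀) * max (cd k) (qT k) * |g k - g' k|) := by ring

end Augmented

end Summit.QuantumFields.BalabanUV.T4Continuum.NE9AugmentedPencil

end
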